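import Literature.NumberTheory.ComplexMultiplication.FiniteQAlgebraLatticePowersInvertible
import Literature.LinearAlgebra.Matrix.CyclicVectorCompanionMatrix
import Mathlib.LinearAlgebra.Matrix.Charpoly.Minpoly
import Mathlib.LinearAlgebra.Matrix.Basis
import Mathlib.RingTheory.AdjoinRoot
import HarnessLib

/-!
# LATIMER–MACDUFFEE (1933) FOR AN ARBITRARY MONIC POLYNOMIAL: the `GLₙ(ℤ)`-conjugacy classes of REGULAR integer
# matrices with characteristic polynomial `g` are the `ε`-classes of the full `θ`-stable lattices of
# `A_g = ℚ[t]/(g)` (Hertling–Larabi 2026b, Theorem 6.2 [LMD33])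

Topic `Literature/LinearAlgebra/Matrix`, namespace `Literature.LinearAlgebra.Matrix.LatimerMacDuffeeRegular`; lane
`lit-hodgefound` (Track 2 foundations library), seat p19 generation 35, row g35-#3.  The tree's Latimer–MacDuffee–Taussky
series (`LatimerMacDuffee.lean`, `…Ideal`, `…Correspondence`, `…Companion`, `…Transpose`, `…DegreeOneIdeals`) treats the
IRREDUCIBLE case — `ℤ[X]/(f)` an integral domain, matrix classes ↔ ideal classes of `ℤ[θ]`.  Here `g` is ANY monic
polynomial (repeated roots allowed, so `A_g` may have nilpotents): the matrices are the REGULAR ones (one Jordan block per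
eigenvalue ⟺ minimal polynomial = characteristic polynomial ⟺ a cyclic vector), and the other side is the set of
`ε`-classes `[L]_ε = {cL | c ∈ A_g^{unit}}` of full lattices `L ⊂ A_g` with `θL ⊆ L` — the general-`A` lattice theory of
`Literature/NumberTheory/ComplexMultiplication/FiniteQAlgebraLatticePowersInvertible.lean` (HL 2026 for an arbitrary
finite-dimensional commutative `ℚ`-algebra) applied to the cyclic algebra `A_g`.  THEOREMS ONLY: no definition, no
instance, no named fact (D-0026, net Literature debt `0`), no `sorry`.

## Source, VERBATIM

C. Hertling, K. Larabi, *Conjugacy classes of regular integer matrices*, arXiv:2602.15748 (2026) [HertlingLarabi2026b],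
held `paper:arxiv-2602.15748`, §6 (chunks p0012–p0013): «Definition/Lemma 6.1 […] (c) (Lemma) Let `B ∈ M_{n×n}(k)`.
The following conditions are equivalent. (i) There is a vector `v ∈ M_{n×1}(k)` (called cyclic generator) with
`M_{n×1}(k) = ⊕_{l=0}^{n−1} k·B^lv`. (ii) `B` is `GL_n(k)`-conjugate to `M_{p_B}` […]. (iii) There is a matrix
`C ∈ GL_n(k̄)` such that the matrix `C^{−1}BC` is in Jordan normal form and has for each eigenvalue only one Jordan
block. (iv) `{C ∈ M_{n×n}(k) | BC = CB} = k[B]`. (d) (Definition) A matrix `B ∈ M_{n×n}(k)` which satisfies the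
equivalent conditions in part (c) is called regular. (e) (Definition) For any matrix `B ∈ M_{n×n}(ℤ)` denote by
`[B]_ℤ := {C^{−1}BC | C ∈ GL_n(ℤ)}` the `GL_n(ℤ)`-conjugacy class of `B`. […]
**Theorem 6.2 (LMD33).** Let `n ∈ ℕ` and let `f ∈ ℤ[t]` be unitary of degree `n`. There is a natural 1:1
correspondence between the sets `S_{1,f}` and `S_{2,f}` where `S_{1,f} := {[B]_ℤ | B ∈ M_{n×n}(ℤ) is regular with
p_B = f}`, `S_{2,f} := {[L]_ε | L ∈ 𝓛(A_f) with 𝒪(L) ⊃ Λ_f}` [`A_f := ℚ[t]/(f) ⊃ Λ_f := ℤ[t]/(f)`].  `S_{1,f}` is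
the set of `GL_n(ℤ)`-conjugacy classes of regular integer matrices with characteristic polynomial `f`, and `S_{2,f}`
is the subsemigroup of `𝓔(A_f)` which consists of the `ε`-classes of full lattices in `A` which are `Λ_f`-ideals.
(i) From `B` with `[B]_ℤ ∈ S_{1,f}` to `L` with `[L]_ε ∈ S_{2,f}`: Choose `C ∈ GL_n(ℚ)` with `CBC^{−1} = M_f`. Denote
`t̄ := [t] ∈ Λ_f ⊂ A_f` and define `(b_1,...,b_n) := 𝔅 := (1, t̄, t̄², ..., t̄^{n−1})·C`, `L := ⊕_{i=1}^n ℤ·b_i`.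
(ii) From `L` with `[L]_ε ∈ S_{2,f}` to `B` with `[B]_ℤ ∈ S_{1,f}`. Choose a `ℤ`-basis `(b_1,...,b_n)` of `L`. Then
`t̄(b_1,...,b_n) := (t̄b_1,...,t̄b_n) = (b_1,...,b_n)·B` for a unique matrix `B ∈ M_{n×n}(ℤ)`.
Proof: The endomorphism `μ_t̄ := (multiplication with t̄) : A_f → A_f` is regular with characteristic polynomial `f`.
Any full lattice `L ∈ 𝓛(A_f)` induces by (6.5) a `GL_n(ℤ)`-conjugacy class of regular matrices in `M_{n×n}(ℚ)`
with characteristic polynomial `f`. It consists of matrices in `M_{n×n}(ℤ)` if and only if `t̄L ⊂ L`, so if and only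
if `𝒪(L) ⊃ Λ_f`. Any class `[B]_ℤ ∈ S_{1,f}` is obtained by this construction […]. Suppose that two full lattices
`L_1` and `L_2` […] give the same conjugacy class `[B]_ℤ`. Then there are `ℤ`-bases `𝔅_1` of `L_1` and `𝔅_2` of
`L_2` with `μ_t̄𝔅_1 = 𝔅_1·B` and `μ_t̄𝔅_2 = 𝔅_2·B`. Write `𝔅_2 = 𝔅_1·C` for some matrix `C ∈ GL_n(ℚ)`. Then
`BC = CB`, so by Lemma 6.1 (c) (iv) `C = Σ c_lB^l ∈ ℚ[B]`. The element `c := Σ c_l t̄^l` satisfies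
`c ∈ A_f^{unit}`, `c𝔅_1 = 𝔅_2`, `cL_1 = L_2`, so `[L_1]_ε = [L_2]_ε`.»  Remarks 6.3 (iii): «The unit element
`[Λ_f]` in `S_{2,f}` corresponds to the `GL_n(ℤ)`-conjugacy class `[M_f]_ℤ` in `S_{1,f}`.»

C. G. Latimer, C. C. MacDuffee, *A correspondence between classes of ideals and classes of matrices*, Ann. of Math.
34 (1933) 313–316 [LatimerMacduffee1933] — HL's «[LMD33]».

## What is formalised (for `g ∈ ℚ[X]` monic of degree `n`; `A_g = AdjoinRoot g`, `θ = AdjoinRoot.root g`)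

An integer matrix `B` is «regular with `p_B = g`» iff `minpoly_ℚ B = g` (for `g = f ∈ ℤ[t]`:
`minpoly_map_eq_iff_charpoly_eq_and_natDegree_eq`, HL (c)(ii) ⟺ (d) being the tree's
`CyclicVectorCompanionMatrix`); a `ℤ`-basis `𝔅 = (b_j)` of a lattice REPRESENTS `B` when «`t̄(b_1,...,b_n) =
(b_1,...,b_n)·B`», i.e. `θ·b_j = Σ_i B_{ij} b_i`.
* §1 `A_g`: `finrank_adjoinRoot`, `minpoly_root`; the span of a `ℚ`-basis is a full lattice
  (`isFullLattice_span_range_basis`, any `ℚ`-algebra); representation ⟺ `LinearMap.toMatrix 𝔅 𝔅 (μ_θ) = B`;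
  `θL ⊆ L ⟺ ℤ[θ]L ⊆ L ⟺ 𝒪(L) ⊇ Λ_g` (`forall_adjoin_mul_mem_iff`, `toSubmodule_adjoin_le_div_iff`).
* §2 (ii) LATTICE ↦ MATRIX: `exists_basis_matrix_of_isFullLattice` — a full `θ`-stable `L` has a `ℤ`-basis, the matrix
  of `μ_θ` in it is integral with `minpoly_ℚ = g`.
* §3 (i) MATRIX ↦ LATTICE: `exists_basis_of_minpoly_eq` — for `minpoly_ℚ B = g` a cyclic vector `v` (tree: Hungerford
  VII.4.3) gives the `ℚ[t]`-module isomorphism `ℚⁿ_B ≅ A_g`, `p(B)v ↤ p(θ)` (through `Ideal.Quotient.lift` of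
  `p ↦ p(B)`), and the image `𝔅` of the standard basis spans a full `θ`-stable lattice representing `B`.
* §4 well-definedness: two `ℤ`-bases of `ε`-equivalent lattices represent `GL_n(ℤ)`-conjugate matrices
  (`exists_isUnit_det_mul_eq_mul_of_span_eq`, `…_of_units_smul_eq`; the base change `P = 𝔅'⁻¹𝔅` is unimodular).
* §5 injectivity: «`BC = CB` ⟹ `C ∈ ℚ[B]` ⟹ `c ∈ A_f^{unit}`, `cL_1 = L_2`» — here: the `ℚ`-linear map with matrix
  `P` intertwining `μ_θ` is `A_g`-linear (`A_g = ℚ[θ]`), hence the multiplication by a unit `c`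
  (`exists_mul_eq_toLin`, `exists_units_smul_eq_of_mul_eq_mul`).
* §6 **THEOREM 6.2 [LMD33]: a bijection `Φ : S_{1,g} ≃ S_{2,g}` with `Φ [B]_ℤ = [L]_ε` whenever a `ℤ`-basis of `L`
  represents `B`** (`exists_equiv_quot_conj_quot_units_smul`), and `natCard_quot_conj_eq_natCard_quot_units_smul`.
* §7 Remark 6.3 (iii): the companion matrix `M_f` is represented by the basis `(1, θ, …, θ^{n−1})` of `Λ_f = ℤ[θ]`
  (`root_mul_pow_eq_sum_companion`, with the tree's `Literature.LinearAlgebra.Matrix.companion`), so `Φ [M_f]_ℤ = [Λ_f]_ε`.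
NOT here: the finiteness of `S_{1,g}` for square-free `g` (Remark 6.3 (iv), via Jordan–Zassenhaus ∕ HL 2026 Thm. 6.3)
and its infinitude otherwise — sequel rows.

## References
* [HertlingLarabi2026b] C. Hertling, K. Larabi, arXiv:2602.15748 (2026), §6 Def./Lemma 6.1, Thm. 6.2, Rem. 6.3 (iii).
  [cite: HertlingLarabi2026b, §6 Thm. 6.2, chunks p0012–p0013]
* [LatimerMacduffee1933] C. G. Latimer, C. C. MacDuffee, Ann. of Math. 34 (1933) 313–316.
  [cite: LatimerMacduffee1933, as cited by HertlingLarabi2026b Thm. 6.2 «(LMD33)»]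
* [Taussky1949] O. Taussky, Canad. J. Math. 1 (1949) 300–302 (the irreducible case; the tree's series).
* [Hungerford1974] T. W. Hungerford, *Algebra*, Thm. VII.4.3 (cyclic vectors; the tree's `CyclicVectorCompanionMatrix`).
-/

noncomputable section

open scoped Classical Pointwise
open Polynomial Module Submodule Matrix

namespace Literature.LinearAlgebra.Matrix.LatimerMacDuffeeRegular

open Literature.NumberTheory.Automorphic (IsFullLattice)

variable {n : ℕ} {g : ℚ[X]}

/-! ## §1 The cyclic algebra `A_g = ℚ[t]/(g)` and bases representing a matrix -/

/-- `dim_ℚ A_g = deg g` («`A_f` is an `n`-dimensional commutative ℚ-algebra»). [cite: HertlingLarabi2026b, §6 (before Def./Lemma 6.1), chunk p0012] -/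
theorem finrank_adjoinRoot (hg : g.Monic) (hdeg : g.natDegree = n) : finrank ℚ (AdjoinRoot g) = n := by
  rw [(AdjoinRoot.powerBasis hg.ne_zero).finrank, AdjoinRoot.powerBasis_dim, hdeg]

/-- The minimal polynomial of `θ = t̄` over `ℚ` is `g` («`μ_t̄` is regular with characteristic polynomial `f`»).
[cite: HertlingLarabi2026b, §6 Thm. 6.2 (proof), chunk p0013] -/
theorem minpoly_root (hg : g.Monic) : minpoly ℚ (AdjoinRoot.root g) = g := by
  have h := AdjoinRoot.minpoly_powerBasis_gen_of_monic (K := ℚ) hg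
  rwa [AdjoinRoot.powerBasis_gen] at h

/-- The minimal polynomial of `μ_θ = (multiplication with θ)` is `g`. [cite: HertlingLarabi2026b, §6 Thm. 6.2 (proof, «The endomorphism `μ_t̄` […] is regular with characteristic polynomial `f`»), chunk p0013] -/
theorem minpoly_mulLeft_root (hg : g.Monic) : minpoly ℚ (LinearMap.mulLeft ℚ (AdjoinRoot.root g)) = g := by
  have e : LinearMap.mulLeft ℚ (AdjoinRoot.root g) = Algebra.lmul ℚ (AdjoinRoot g) (AdjoinRoot.root g) :=
    LinearMap.ext fun x => by rw [LinearMap.mulLeft_apply, Algebra.coe_lmul_eq_mul, LinearMap.mul_apply']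
  rw [e, minpoly.algHom_eq _ (Algebra.lmul_injective (R := ℚ) (A := AdjoinRoot g)), minpoly_root hg]

/-- **The `ℤ`-span of a `ℚ`-basis of a `ℚ`-algebra is a full lattice** («`L := ⊕ ℤ·b_i`» is a full lattice).
[cite: HertlingLarabi2026b, §6 Thm. 6.2 (i), chunk p0012] [cite: HertlingLarabi2026, §2 Def. 2.1 (a), chunk p0005] -/
theorem isFullLattice_span_range_basis {A : Type*} [Ring A] [Algebra ℚ A] {ι : Type*} [Fintype ι]
    (b : Basis ι ℚ A) : IsFullLattice A (span ℤ (Set.range b)) := by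
  refine ⟨Submodule.fg_span (Set.finite_range b), fun d => ?_⟩
  -- a common denominator of the coordinates of `d`
  have hN : ∀ i, ∃ z : ℤ, (z : ℚ) = (∏ k, ((b.repr d k).den : ℤ) : ℤ) * b.repr d i := fun i => by
    refine ⟨(∏ k ∈ Finset.univ.erase i, ((b.repr d k).den : ℤ)) * (b.repr d i).num, ?_⟩
    rw [← Finset.prod_erase_mul _ _ (Finset.mem_univ i), Int.cast_mul, Int.cast_mul, mul_assoc,
      Int.cast_natCast, ← Rat.mul_den_eq_num, mul_comm (b.repr d i)]
  choose z hz using hN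
  refine ⟨∏ k, ((b.repr d k).den : ℤ), Finset.prod_ne_zero_iff.2 fun k _ =>
    Int.natCast_ne_zero.2 (b.repr d k).den_nz, ?_⟩
  have hd : (∏ k, ((b.repr d k).den : ℤ)) • d = ∑ i, z i • b i := by
    calc (∏ k, ((b.repr d k).den : ℤ)) • d = (∏ k, ((b.repr d k).den : ℤ)) • ∑ i, b.repr d i • b i := by
          rw [b.sum_repr]
      _ = ∑ i, z i • b i := by
          rw [Finset.smul_sum]
          refine Finset.sum_congr rfl fun i _ => ?_
          rw [← Int.cast_smul_eq_zsmul ℚ, smul_smul, ← hz i, Int.cast_smul_eq_zsmul]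
  rw [hd]
  exact sum_mem fun i _ => smul_mem _ _ (subset_span ⟨i, rfl⟩)

section Represents

variable {A : Type*} [Ring A] [Algebra ℚ A] {θ : A} {b : Basis (Fin n) ℚ A} {B : Matrix (Fin n) (Fin n) ℤ}

/-- «`t̄(b_1,...,b_n) = (b_1,...,b_n)·B`» means: the matrix of `μ_t̄` in the basis `𝔅` is `B`.
[cite: HertlingLarabi2026b, §6 Thm. 6.2 (6.5), chunk p0012] -/
theorem toMatrix_mulLeft_eq_map (h : ∀ j, θ * b j = ∑ i, (B i j : ℚ) • b i) :
    LinearMap.toMatrix b b (LinearMap.mulLeft ℚ θ) = B.map (Int.castRingHom ℚ) := by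
  ext i j
  rw [LinearMap.toMatrix_apply, LinearMap.mulLeft_apply, h j, b.repr_sum_self]
  simp

/-- Conversely, `LinearMap.toMatrix 𝔅 𝔅 (μ_t̄) = B` gives «`t̄(b_1,...,b_n) = (b_1,...,b_n)·B`».
[cite: HertlingLarabi2026b, §6 Thm. 6.2 (6.5), chunk p0012] -/
theorem forall_mul_eq_sum_of_toMatrix_eq (h : LinearMap.toMatrix b b (LinearMap.mulLeft ℚ θ) = B.map (Int.castRingHom ℚ)) :
    ∀ j, θ * b j = ∑ i, (B i j : ℚ) • b i := fun j => by
  have h1 : LinearMap.mulLeft ℚ θ = Matrix.toLin b b (B.map (Int.castRingHom ℚ)) := by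
    rw [← h, Matrix.toLin_toMatrix]
  have h2 := LinearMap.congr_fun h1 (b j)
  rw [LinearMap.mulLeft_apply, Matrix.toLin_self] at h2
  simpa using h2

/-- The coordinates of `t̄b_j` in `𝔅` are the `j`-th column of `B`. [cite: HertlingLarabi2026b, §6 Thm. 6.2 (6.5), chunk p0012] -/
theorem repr_mul_basis (h : ∀ j, θ * b j = ∑ i, (B i j : ℚ) • b i) (i j : Fin n) :
    b.repr (θ * b j) i = (B i j : ℚ) := by
  rw [h j, b.repr_sum_self]

/-- A representing basis spans a `θ`-STABLE lattice: «It consists of matrices in `M_{n×n}(ℤ)` if and only if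
`t̄L ⊂ L`» (⟸). [cite: HertlingLarabi2026b, §6 Thm. 6.2 (proof), chunk p0013] -/
theorem mul_mem_span_of_forall_mul_eq_sum (h : ∀ j, θ * b j = ∑ i, (B i j : ℚ) • b i) {x : A}
    (hx : x ∈ span ℤ (Set.range b)) : θ * x ∈ span ℤ (Set.range b) := by
  refine Submodule.span_induction (p := fun x _ => θ * x ∈ span ℤ (Set.range b)) ?_ ?_ ?_ ?_ hx
  · rintro _ ⟨j, rfl⟩
    rw [h j]
    exact sum_mem fun i _ => by
      rw [Int.cast_smul_eq_zsmul]
      exact smul_mem _ _ (subset_span ⟨i, rfl⟩)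
  · rw [mul_zero]; exact zero_mem _
  · intro x y _ _ hx hy
    rw [mul_add]; exact add_mem hx hy
  · intro z x _ hx
    rw [mul_smul_comm]; exact smul_mem _ _ hx

/-- `[cL]_ε`: the basis `c𝔅 = (cb_1, …, cb_n)` of `cL` represents the SAME matrix (`t̄(cb_j) = c(t̄b_j)`).
[cite: HertlingLarabi2026b, §6 Thm. 6.2 (proof: «`c𝔅_1 = 𝔅_2`, `cL_1 = L_2`»), chunk p0013] -/
theorem exists_basis_units_smul (h : ∀ j, θ * b j = ∑ i, (B i j : ℚ) • b i) (c : Aˣ)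
    (hc : (c : A) * θ = θ * c) :
    ∃ b' : Basis (Fin n) ℚ A, (∀ j, b' j = c * b j) ∧
      span ℤ (Set.range b') = c • span ℤ (Set.range b) ∧ ∀ j, θ * b' j = ∑ i, (B i j : ℚ) • b' i := by
  let e : A ≃ₗ[ℚ] A :=
    { toFun := fun x => (c : A) * x
      invFun := fun x => ((c⁻¹ : Aˣ) : A) * x
      map_add' := fun x y => mul_add _ _ _
      map_smul' := fun q x => mul_smul_comm _ _ _
      left_inv := fun x => by simp [← mul_assoc]
      right_inv := fun x => by simp [← mul_assoc] }
  have he : ∀ j, b.map e j = c * b j := fun j => by rw [Basis.map_apply]; rfl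
  refine ⟨b.map e, he, ?_, fun j => ?_⟩
  · rw [Units.smul_def, Submodule.smul_span, Set.smul_set_range]
    congr 1
  · rw [he, ← mul_assoc, ← hc, mul_assoc, h j, Finset.mul_sum]
    refine Finset.sum_congr rfl fun i _ => ?_
    rw [he, mul_smul_comm]

end Represents

/-- **«`t̄L ⊂ L`, so if and only if `𝒪(L) ⊃ Λ_f`»: a `ℤ`-submodule is `θ`-stable iff it is a `Λ_g = ℤ[θ]`-module.**
[cite: HertlingLarabi2026b, §6 Thm. 6.2 (proof), chunk p0013] -/
theorem forall_adjoin_mul_mem_iff {L : Submodule ℤ (AdjoinRoot g)} :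
    (∀ a ∈ Algebra.adjoin ℤ ({AdjoinRoot.root g} : Set (AdjoinRoot g)), ∀ x ∈ L, a * x ∈ L) ↔
      ∀ x ∈ L, AdjoinRoot.root g * x ∈ L := by
  refine ⟨fun h x hx => h _ (Algebra.subset_adjoin (Set.mem_singleton _)) x hx, fun h a ha => ?_⟩
  refine Algebra.adjoin_induction (p := fun a _ => ∀ x ∈ L, a * x ∈ L) ?_ ?_ ?_ ?_ ha
  · intro y hy x hx
    rw [Set.mem_singleton_iff.1 hy]
    exact h x hx
  · intro z x hx
    rw [Algebra.algebraMap_eq_smul_one, smul_mul_assoc, one_mul]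
    exact L.smul_mem z hx
  · intro y y' _ _ hy hy' x hx
    rw [add_mul]
    exact add_mem (hy x hx) (hy' x hx)
  · intro y y' _ _ hy hy' x hx
    rw [mul_assoc]
    exact hy _ (hy' x hx)

/-- The same as «`𝒪(L) ⊃ Λ_f`»: `Λ_g = ℤ[θ] ⊆ 𝒪(L) = L:L` iff `θL ⊆ L`. [cite: HertlingLarabi2026b, §6 Thm. 6.2 («`S_{2,f} := {[L]_ε | L ∈ 𝓛(A_f) with 𝒪(L) ⊃ Λ_f}`»), chunk p0012] -/
theorem toSubmodule_adjoin_le_div_iff {L : Submodule ℤ (AdjoinRoot g)} :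
    Subalgebra.toSubmodule (Algebra.adjoin ℤ ({AdjoinRoot.root g} : Set (AdjoinRoot g))) ≤ L / L ↔
      ∀ x ∈ L, AdjoinRoot.root g * x ∈ L := by
  rw [← forall_adjoin_mul_mem_iff]
  constructor
  · intro h a ha x hx
    exact (Submodule.mem_div_iff_forall_mul_mem.1 (h (show a ∈ Subalgebra.toSubmodule _ from ha))) x hx
  · intro h a ha
    exact Submodule.mem_div_iff_forall_mul_mem.2 (h a ha)

/-! ## §2 (ii) From a full `θ`-stable lattice to a regular integer matrix -/

/-- **THEOREM 6.2 (ii): «Choose a `ℤ`-basis `(b_1,...,b_n)` of `L`. Then `t̄(b_1,...,b_n) = (b_1,...,b_n)·B` for a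
unique matrix `B ∈ M_{n×n}(ℤ)`», and `B` is regular with `p_B = g` (`minpoly_ℚ B = g`).** The `ℤ`-basis is a
`ℚ`-basis of `A_g` (general-`A` lattice theory, `FiniteQAlgebraLattice.exists_basis_fin_span_eq`); the coordinates of
`t̄b_j ∈ L` are integers; the matrix is that of `μ_t̄`, whose minimal polynomial is `g`.
[cite: HertlingLarabi2026b, §6 Thm. 6.2 (ii) and proof, chunks p0012–p0013] -/
theorem exists_basis_matrix_of_isFullLattice (hg : g.Monic) (hdeg : g.natDegree = n)
    {L : Submodule ℤ (AdjoinRoot g)} (hL : IsFullLattice (AdjoinRoot g) L)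
    (hθ : ∀ x ∈ L, AdjoinRoot.root g * x ∈ L) :
    ∃ (b : Basis (Fin n) ℚ (AdjoinRoot g)) (B : Matrix (Fin n) (Fin n) ℤ),
      span ℤ (Set.range b) = L ∧ (∀ j, AdjoinRoot.root g * b j = ∑ i, (B i j : ℚ) • b i) ∧
      minpoly ℚ (B.map (Int.castRingHom ℚ)) = g := by
  haveI : Module.Finite ℚ (AdjoinRoot g) := (AdjoinRoot.powerBasis hg.ne_zero).finite
  obtain ⟨b₀, hb₀⟩ :=
    Literature.NumberTheory.ComplexMultiplication.FiniteQAlgebraLattice.exists_basis_fin_span_eq hL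
  obtain ⟨b, hb⟩ : ∃ b : Basis (Fin n) ℚ (AdjoinRoot g), span ℤ (Set.range b) = L :=
    ⟨b₀.reindex (finCongr (finrank_adjoinRoot hg hdeg)), by rw [Basis.range_reindex]; exact hb₀⟩
  have hint : ∀ i j, ∃ z : ℤ, (z : ℚ) = b.repr (AdjoinRoot.root g * b j) i := fun i j => by
    have hmem : AdjoinRoot.root g * b j ∈ span ℤ (Set.range b) := by
      rw [hb]
      exact hθ _ (hb ▸ subset_span ⟨j, rfl⟩)
    obtain ⟨z, hz⟩ := (Basis.mem_span_iff_repr_mem ℤ b _).1 hmem i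
    exact ⟨z, by simpa using hz⟩
  choose B hB using hint
  have hrep : ∀ j, AdjoinRoot.root g * b j = ∑ i, (B i j : ℚ) • b i := fun j => by
    conv_lhs => rw [← b.sum_repr (AdjoinRoot.root g * b j)]
    simp only [hB]
  refine ⟨b, B, hb, hrep, ?_⟩
  rw [← toMatrix_mulLeft_eq_map hrep, LinearMap.minpoly_toMatrix, minpoly_mulLeft_root hg]

/-! ## §3 (i) From a regular integer matrix to a full `θ`-stable lattice -/

/-- **THEOREM 6.2 (i): every regular integer matrix `B` with `p_B = g` (`minpoly_ℚ B = g`) is represented by a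
`ℤ`-basis `𝔅` of `A_g` spanning a full `θ`-stable lattice** («Choose `C ∈ GL_n(ℚ)` with `CBC^{−1} = M_f` […]
`𝔅 := (1, t̄, …, t̄^{n−1})·C`, `L := ⊕ ℤ·b_i`», «`μ_t̄𝔅 = 𝔅·B`»).  Here: a cyclic vector `v` of `B` (Hungerford
VII.4.3, the tree's `exists_forall_aeval_apply_eq_zero_imp`) yields the `ℚ[t]`-linear ISOMORPHISM `A_g → ℚⁿ`,
`p(t̄) ↦ p(B)v`, and `𝔅` is the preimage of the standard basis. [cite: HertlingLarabi2026b, §6 Thm. 6.2 (i) and proof, chunks p0012–p0013] [cite: Hungerford1974, Thm. VII.4.3] -/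
theorem exists_basis_of_minpoly_eq (hg : g.Monic) (hdeg : g.natDegree = n) {B : Matrix (Fin n) (Fin n) ℤ}
    (hB : minpoly ℚ (B.map (Int.castRingHom ℚ)) = g) :
    ∃ b : Basis (Fin n) ℚ (AdjoinRoot g), ∀ j, AdjoinRoot.root g * b j = ∑ i, (B i j : ℚ) • b i := by
  haveI : Module.Finite ℚ (AdjoinRoot g) := (AdjoinRoot.powerBasis hg.ne_zero).finite
  set Bq : Matrix (Fin n) (Fin n) ℚ := B.map (Int.castRingHom ℚ) with hBq
  -- the ring homomorphism `Ψ : A_g → M_n(ℚ)`, `p(t̄) ↦ p(B)`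
  have hker : ∀ p ∈ Ideal.span ({g} : Set ℚ[X]), (aeval Bq).toRingHom p = 0 := fun p hp => by
    obtain ⟨q, rfl⟩ := Ideal.mem_span_singleton'.1 hp
    change aeval Bq (q * g) = 0
    rw [map_mul, ← hB, minpoly.aeval, mul_zero]
  let Ψ : AdjoinRoot g →+* Matrix (Fin n) (Fin n) ℚ := Ideal.Quotient.lift _ (aeval Bq).toRingHom hker
  have hΨ : ∀ p : ℚ[X], Ψ (AdjoinRoot.mk g p) = aeval Bq p := fun p => rfl
  have hΨθ : Ψ (AdjoinRoot.root g) = Bq := by rw [← AdjoinRoot.mk_X, hΨ, aeval_X]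
  have hΨalg : Ψ.comp (algebraMap ℚ (AdjoinRoot g)) = algebraMap ℚ (Matrix (Fin n) (Fin n) ℚ) :=
    RingHom.ext_rat _ _
  -- a cyclic vector
  obtain ⟨v, hv⟩ := Literature.LinearAlgebra.Matrix.exists_forall_aeval_apply_eq_zero_imp (Matrix.toLin' Bq)
  have hli := Literature.LinearAlgebra.Matrix.linearIndependent_pow_apply_of_forall_aeval _ v hv
  have hd : (minpoly ℚ (Matrix.toLin' Bq)).natDegree = n := by rw [Matrix.minpoly_toLin', hB, hdeg]
  -- the `ℚ`-linear map `a ↦ Ψ(a)v`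
  let Ψv : AdjoinRoot g →ₗ[ℚ] (Fin n → ℚ) :=
    { toFun := fun a => Ψ a *ᵥ v
      map_add' := fun a a' => by simp only [map_add, Matrix.add_mulVec]
      map_smul' := fun q a => by
        simp only [RingHom.id_apply]
        rw [Algebra.smul_def, map_mul, ← Matrix.mulVec_mulVec, ← RingHom.comp_apply, hΨalg,
          Algebra.algebraMap_eq_smul_one, Matrix.smul_mulVec, Matrix.one_mulVec] }
  have hΨv : ∀ a, Ψv a = Ψ a *ᵥ v := fun a => rfl
  have hΨv_pow : ∀ k : ℕ, Ψv (AdjoinRoot.root g ^ k) = (Matrix.toLin' Bq ^ k) v := fun k => by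
    rw [hΨv, map_pow, hΨθ, ← Matrix.toLin'_pow, Matrix.toLin'_apply]
  have hli' : LinearIndependent ℚ fun k : Fin n => Ψv (AdjoinRoot.root g ^ (k : ℕ)) := by
    have e : (fun k : Fin n => Ψv (AdjoinRoot.root g ^ (k : ℕ))) =
        (fun k : Fin (minpoly ℚ (Matrix.toLin' Bq)).natDegree => (Matrix.toLin' Bq ^ (k : ℕ)) v) ∘
          finCongr hd.symm := by
      funext k
      simp only [Function.comp_apply, finCongr_apply, Fin.val_cast, hΨv_pow]
    rw [e]
    exact hli.comp _ (finCongr hd.symm).injective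
  have hsurj : Function.Surjective Ψv := by
    have hsp : span ℚ (Set.range fun k : Fin n => Ψv (AdjoinRoot.root g ^ (k : ℕ))) = ⊤ :=
      hli'.span_eq_top_of_card_eq_finrank' (by simp)
    rw [← LinearMap.range_eq_top, eq_top_iff, ← hsp, Submodule.span_le]
    rintro _ ⟨k, rfl⟩
    exact LinearMap.mem_range_self Ψv _
  have hinj : Function.Injective Ψv :=
    (LinearMap.injective_iff_surjective_of_finrank_eq_finrank
      (by rw [finrank_adjoinRoot hg hdeg, Module.finrank_fin_fun])).2 hsurj
  let e : AdjoinRoot g ≃ₗ[ℚ] (Fin n → ℚ) := LinearEquiv.ofBijective Ψv ⟨hinj, hsurj⟩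
  have he : ∀ a, e a = Ψ a *ᵥ v := fun a => rfl
  let b : Basis (Fin n) ℚ (AdjoinRoot g) := (Pi.basisFun ℚ (Fin n)).map e.symm
  have hb : ∀ j, b j = e.symm (Pi.single j 1) := fun j => by simp [b]
  refine ⟨b, fun j => e.injective ?_⟩
  have h1 : e (AdjoinRoot.root g * b j) = Bq *ᵥ Pi.single j 1 := by
    rw [he, map_mul, hΨθ, ← Matrix.mulVec_mulVec, ← he, hb, LinearEquiv.apply_symm_apply]
  have h2 : e (∑ i, (B i j : ℚ) • b i) = fun i => (B i j : ℚ) := by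
    simp only [map_sum, map_smul, hb, LinearEquiv.apply_symm_apply]
    simpa [Pi.basisFun_apply, Pi.basisFun_repr] using (Pi.basisFun ℚ (Fin n)).sum_repr fun i => (B i j : ℚ)
  rw [h1, h2, Matrix.mulVec_single_one]
  funext i
  simp [hBq]

/-- **THEOREM 6.2 (i), lattice form: every regular integer matrix with `p_B = g` comes from a full `θ`-stable lattice
of `A_g`** («Any class `[B]_ℤ ∈ S_{1,f}` is obtained by this construction»). [cite: HertlingLarabi2026b, §6 Thm. 6.2 (i) and proof, chunks p0012–p0013] -/
theorem exists_isFullLattice_of_minpoly_eq (hg : g.Monic) (hdeg : g.natDegree = n) {B : Matrix (Fin n) (Fin n) ℤ}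
    (hB : minpoly ℚ (B.map (Int.castRingHom ℚ)) = g) :
    ∃ (L : Submodule ℤ (AdjoinRoot g)) (b : Basis (Fin n) ℚ (AdjoinRoot g)),
      IsFullLattice (AdjoinRoot g) L ∧ (∀ x ∈ L, AdjoinRoot.root g * x ∈ L) ∧ span ℤ (Set.range b) = L ∧
      ∀ j, AdjoinRoot.root g * b j = ∑ i, (B i j : ℚ) • b i := by
  obtain ⟨b, hb⟩ := exists_basis_of_minpoly_eq hg hdeg hB
  exact ⟨span ℤ (Set.range b), b, isFullLattice_span_range_basis b, fun x hx => mul_mem_span_of_forall_mul_eq_sum hb hx,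
    rfl, hb⟩

/-! ## §4 Well-definedness: bases of `ε`-equivalent lattices represent `GL_n(ℤ)`-conjugate matrices -/

/-- The base-change matrix between two `ℤ`-bases, one spanning a sublattice of the other's span, is INTEGRAL.
[cite: HertlingLarabi2026b, §6 Thm. 6.2 (proof: «Write `𝔅_2 = 𝔅_1·C`»), chunk p0013] -/
theorem exists_map_eq_toMatrix {A : Type*} [Ring A] [Algebra ℚ A] {b b' : Basis (Fin n) ℚ A}
    (h : span ℤ (Set.range b) ≤ span ℤ (Set.range b')) :
    ∃ P : Matrix (Fin n) (Fin n) ℤ, P.map (Int.castRingHom ℚ) = b'.toMatrix b := by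
  have hint : ∀ i j, ∃ z : ℤ, (z : ℚ) = b'.toMatrix b i j := fun i j => by
    rw [Basis.toMatrix_apply]
    obtain ⟨z, hz⟩ := (Basis.mem_span_iff_repr_mem ℤ b' (b j)).1 (h (subset_span ⟨j, rfl⟩)) i
    exact ⟨z, by simpa using hz⟩
  choose P hP using hint
  exact ⟨Matrix.of P, by ext i j; simp [hP]⟩

/-- Entrywise `ℤ → ℚ` on integer matrices is injective (private plumbing). [folklore] -/
private theorem map_int_injective :
    Function.Injective fun M : Matrix (Fin n) (Fin n) ℤ => M.map (Int.castRingHom ℚ) := fun M N h =>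
  Matrix.ext fun i j => by simpa using congr_fun (congr_fun h i) j

/-- **Two `ℤ`-bases of the SAME lattice represent `GL_n(ℤ)`-conjugate matrices: `PB = B'P` with the unimodular base
change `P`** (the class `[B]_ℤ` of (6.5) does not depend on the basis). [cite: HertlingLarabi2026b, §6 Thm. 6.2 (proof: «Any full lattice `L ∈ 𝓛(A_f)` induces by (6.5) a `GL_n(ℤ)`-conjugacy class»), chunk p0013] -/
theorem exists_isUnit_det_mul_eq_mul_of_span_eq {A : Type*} [Ring A] [Algebra ℚ A] {θ : A}
    {b b' : Basis (Fin n) ℚ A} {B B' : Matrix (Fin n) (Fin n) ℤ}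
    (hB : ∀ j, θ * b j = ∑ i, (B i j : ℚ) • b i) (hB' : ∀ j, θ * b' j = ∑ i, (B' i j : ℚ) • b' i)
    (h : span ℤ (Set.range b) = span ℤ (Set.range b')) :
    ∃ P : Matrix (Fin n) (Fin n) ℤ, IsUnit P.det ∧ P * B = B' * P := by
  obtain ⟨P, hP⟩ := exists_map_eq_toMatrix h.le
  obtain ⟨Q, hQ⟩ := exists_map_eq_toMatrix h.ge
  have hPQ : P * Q = 1 := map_int_injective <| by
    change (P * Q).map _ = (1 : Matrix (Fin n) (Fin n) ℤ).map _
    rw [Matrix.map_mul, hP, hQ, Basis.toMatrix_mul_toMatrix_flip, Matrix.map_one _ (map_zero _) (map_one _)]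
  refine ⟨P, Matrix.isUnit_det_of_right_inverse hPQ, map_int_injective ?_⟩
  change (P * B).map _ = (B' * P).map _
  rw [Matrix.map_mul, Matrix.map_mul, hP, ← toMatrix_mulLeft_eq_map hB, ← toMatrix_mulLeft_eq_map hB',
    basis_toMatrix_mul_linearMap_toMatrix, linearMap_toMatrix_mul_basis_toMatrix]

/-- **Bases of `ε`-EQUIVALENT lattices `L`, `cL` (`c ∈ A_g^{unit}`) represent `GL_n(ℤ)`-conjugate matrices** — the map
`[L]_ε ↦ [B]_ℤ` is well defined. [cite: HertlingLarabi2026b, §6 Thm. 6.2 (proof), chunk p0013] -/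
theorem exists_isUnit_det_mul_eq_mul_of_units_smul_eq {b b' : Basis (Fin n) ℚ (AdjoinRoot g)}
    {B B' : Matrix (Fin n) (Fin n) ℤ} (hB : ∀ j, AdjoinRoot.root g * b j = ∑ i, (B i j : ℚ) • b i)
    (hB' : ∀ j, AdjoinRoot.root g * b' j = ∑ i, (B' i j : ℚ) • b' i) (c : (AdjoinRoot g)ˣ)
    (h : c • span ℤ (Set.range b) = span ℤ (Set.range b')) :
    ∃ P : Matrix (Fin n) (Fin n) ℤ, IsUnit P.det ∧ P * B = B' * P := by
  obtain ⟨b₁, -, hb₁, hB₁⟩ := exists_basis_units_smul hB c (mul_comm _ _)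
  exact exists_isUnit_det_mul_eq_mul_of_span_eq hB₁ hB' (hb₁.trans h)

/-! ## §5 Injectivity: lattices representing conjugate matrices are `ε`-equivalent -/

/-- **«`BC = CB`, so `C ∈ ℚ[B]`; the element `c` satisfies `c𝔅_1 = 𝔅_2`»**, coordinate-free: if `𝔅`, `𝔅'` represent
`B`, `B'` and `PB = B'P` for an integer matrix `P`, the `ℚ`-linear map `φ` with matrix `P` (`φ(b_j) = Σ_k P_{kj}b'_k`)
commutes with `μ_t̄`, hence is `A_g = ℚ[t̄]`-linear, hence is the multiplication by `c = φ(1)`.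
[cite: HertlingLarabi2026b, §6 Thm. 6.2 (proof) with Lemma 6.1 (c) (iv), chunks p0012–p0013] -/
theorem exists_mul_eq_toLin {b b' : Basis (Fin n) ℚ (AdjoinRoot g)} {B B' P : Matrix (Fin n) (Fin n) ℤ}
    (hB : ∀ j, AdjoinRoot.root g * b j = ∑ i, (B i j : ℚ) • b i)
    (hB' : ∀ j, AdjoinRoot.root g * b' j = ∑ i, (B' i j : ℚ) • b' i) (hPB : P * B = B' * P) :
    ∃ c : AdjoinRoot g, ∀ x, c * x = Matrix.toLin b b' (P.map (Int.castRingHom ℚ)) x := by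
  set φ := Matrix.toLin b b' (P.map (Int.castRingHom ℚ)) with hφ
  -- `φ` commutes with `μ_θ`: check on matrices
  have hcomm : ∀ x, φ (AdjoinRoot.root g * x) = AdjoinRoot.root g * φ x := by
    have h : φ ∘ₗ LinearMap.mulLeft ℚ (AdjoinRoot.root g) = LinearMap.mulLeft ℚ (AdjoinRoot.root g) ∘ₗ φ := by
      apply (LinearMap.toMatrix b b').injective
      rw [LinearMap.toMatrix_comp b b b', LinearMap.toMatrix_comp b b' b', hφ, LinearMap.toMatrix_toLin,
        toMatrix_mulLeft_eq_map hB, toMatrix_mulLeft_eq_map hB', ← Matrix.map_mul, ← Matrix.map_mul, hPB]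
    intro x
    simpa using LinearMap.congr_fun h x
  -- hence `φ` is `A_g`-linear, `A_g = ℚ[θ]`
  have key : ∀ a : AdjoinRoot g, ∀ x, φ (a * x) = a * φ x := by
    intro a
    have ha : a ∈ Algebra.adjoin ℚ ({AdjoinRoot.root g} : Set (AdjoinRoot g)) := by
      rw [AdjoinRoot.adjoinRoot_eq_top]; exact Algebra.mem_top
    refine Algebra.adjoin_induction (p := fun a _ => ∀ x, φ (a * x) = a * φ x) ?_ ?_ ?_ ?_ ha
    · intro y hy x
      rw [Set.mem_singleton_iff.1 hy]
      exact hcomm x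
    · intro r x
      rw [Algebra.algebraMap_eq_smul_one, smul_mul_assoc, one_mul, map_smul, smul_mul_assoc, one_mul]
    · intro y z _ _ hy hz x
      rw [add_mul, map_add, hy, hz, add_mul]
    · intro y z _ _ hy hz x
      rw [mul_assoc, hy, hz, mul_assoc]
  refine ⟨φ 1, fun x => ?_⟩
  rw [mul_comm, ← key x 1, mul_one]

/-- **INJECTIVITY («`cL_1 = L_2`, so `[L_1]_ε = [L_2]_ε`»): if `ℤ`-bases of `L`, `L'` represent `GL_n(ℤ)`-CONJUGATE
matrices, `PB = B'P` with `P` unimodular, then `cL = L'` for a unit `c ∈ A_g^{unit}`.**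
[cite: HertlingLarabi2026b, §6 Thm. 6.2 (proof, last paragraph), chunk p0013] -/
theorem exists_units_smul_eq_of_mul_eq_mul {b b' : Basis (Fin n) ℚ (AdjoinRoot g)} {B B' P : Matrix (Fin n) (Fin n) ℤ}
    (hB : ∀ j, AdjoinRoot.root g * b j = ∑ i, (B i j : ℚ) • b i)
    (hB' : ∀ j, AdjoinRoot.root g * b' j = ∑ i, (B' i j : ℚ) • b' i) (hP : IsUnit P.det) (hPB : P * B = B' * P) :
    ∃ c : (AdjoinRoot g)ˣ, c • span ℤ (Set.range b) = span ℤ (Set.range b') := by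
  have hPQ : P * P⁻¹ = 1 := Matrix.mul_nonsing_inv P hP
  have hQP : P⁻¹ * P = 1 := Matrix.nonsing_inv_mul P hP
  have hQB : P⁻¹ * B' = B * P⁻¹ := by
    calc P⁻¹ * B' = P⁻¹ * B' * (P * P⁻¹) := by rw [hPQ, mul_one]
      _ = P⁻¹ * (B' * P) * P⁻¹ := by simp only [mul_assoc]
      _ = P⁻¹ * (P * B) * P⁻¹ := by rw [hPB]
      _ = B * P⁻¹ := by rw [← mul_assoc, hQP, one_mul]
  obtain ⟨c, hc⟩ := exists_mul_eq_toLin hB hB' hPB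
  obtain ⟨c', hc'⟩ := exists_mul_eq_toLin hB' hB hQB
  -- `c'c = 1`: the composite has matrix `P⁻¹P = 1`
  have hcc' : c' * c = 1 := by
    have h1 : Matrix.toLin b' b (P⁻¹.map (Int.castRingHom ℚ))
        (Matrix.toLin b b' (P.map (Int.castRingHom ℚ)) 1) = 1 := by
      rw [← LinearMap.comp_apply, ← Matrix.toLin_mul b b' b, ← Matrix.map_mul, hQP,
        Matrix.map_one _ (map_zero _) (map_one _), Matrix.toLin_one, LinearMap.id_apply]
    rw [← hc 1, mul_one, ← hc'] at h1
    exact h1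
  let u : (AdjoinRoot g)ˣ := ⟨c, c', by rw [mul_comm]; exact hcc', hcc'⟩
  -- `cL ⊆ L'` and `c'L' ⊆ L`
  have h1 : ∀ x ∈ span ℤ (Set.range b), c * x ∈ span ℤ (Set.range b') := fun x hx => by
    rw [hc x]
    refine Submodule.span_induction (p := fun x _ => Matrix.toLin b b' (P.map (Int.castRingHom ℚ)) x ∈
      span ℤ (Set.range b')) ?_ (by simp) (fun x y _ _ hx hy => by rw [map_add]; exact add_mem hx hy)
      (fun z x _ hx => by rw [map_zsmul]; exact smul_mem _ _ hx) hx
    rintro _ ⟨j, rfl⟩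
    rw [Matrix.toLin_self]
    exact sum_mem fun k _ => by
      rw [Matrix.map_apply, eq_intCast, Int.cast_smul_eq_zsmul]
      exact smul_mem _ _ (subset_span ⟨k, rfl⟩)
  have h2 : ∀ x ∈ span ℤ (Set.range b'), c' * x ∈ span ℤ (Set.range b) := fun x hx => by
    rw [hc' x]
    refine Submodule.span_induction (p := fun x _ => Matrix.toLin b' b (P⁻¹.map (Int.castRingHom ℚ)) x ∈
      span ℤ (Set.range b)) ?_ (by simp) (fun x y _ _ hx hy => by rw [map_add]; exact add_mem hx hy)
      (fun z x _ hx => by rw [map_zsmul]; exact smul_mem _ _ hx) hx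
    rintro _ ⟨j, rfl⟩
    rw [Matrix.toLin_self]
    exact sum_mem fun k _ => by
      rw [Matrix.map_apply, eq_intCast, Int.cast_smul_eq_zsmul]
      exact smul_mem _ _ (subset_span ⟨k, rfl⟩)
  refine ⟨u, le_antisymm ?_ fun x hx => ?_⟩
  · rintro _ ⟨x, hx, rfl⟩
    exact h1 x hx
  · have hx' : x = u • (c' * x) := by
      rw [Units.smul_def, smul_eq_mul, ← mul_assoc, show (u : AdjoinRoot g) = c from rfl, mul_comm c c', hcc',
        one_mul]
    rw [hx']
    exact Submodule.smul_mem_pointwise_smul _ _ _ (h2 x hx)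

/-! ## §6 THEOREM 6.2 [LMD33]: the correspondence `S_{1,g} ≃ S_{2,g}` -/

/-- **HERTLING–LARABI THEOREM 6.2 = LATIMER–MACDUFFEE 1933 FOR AN ARBITRARY MONIC `g`: a bijection `Φ` from
`S_{1,g}`, the `GLₙ(ℤ)`-conjugacy classes (`PB = B'P`, `P` unimodular) of the REGULAR integer `n × n` matrices with
characteristic polynomial `g` (`minpoly_ℚ B = g`), onto `S_{2,g}`, the `ε`-classes (`L' = cL`, `c ∈ A_g^{unit}`) of
the full lattices `L ⊂ A_g = ℚ[t]/(g)` with `t̄L ⊆ L`, characterised by `Φ [B]_ℤ = [L]_ε` whenever a `ℤ`-basis `𝔅` of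
`L` satisfies «`t̄𝔅 = 𝔅·B`»** («There is a natural 1:1 correspondence between the sets `S_{1,f}` and `S_{2,f}`»).
[cite: HertlingLarabi2026b, §6 Thm. 6.2 (LMD33), chunks p0012–p0013] [cite: LatimerMacduffee1933, as cited by HertlingLarabi2026b Thm. 6.2] -/
theorem exists_equiv_quot_conj_quot_units_smul (hg : g.Monic) (hdeg : g.natDegree = n) :
    ∃ Φ : Quot (fun B B' : {B : Matrix (Fin n) (Fin n) ℤ // minpoly ℚ (B.map (Int.castRingHom ℚ)) = g} =>
              ∃ P : Matrix (Fin n) (Fin n) ℤ, IsUnit P.det ∧ P * B.1 = B'.1 * P) ≃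
          Quot (fun L L' : {L : Submodule ℤ (AdjoinRoot g) //
              IsFullLattice (AdjoinRoot g) L ∧ ∀ x ∈ L, AdjoinRoot.root g * x ∈ L} =>
            ∃ c : (AdjoinRoot g)ˣ, c • L.1 = L'.1),
      ∀ (B : {B : Matrix (Fin n) (Fin n) ℤ // minpoly ℚ (B.map (Int.castRingHom ℚ)) = g})
        (L : {L : Submodule ℤ (AdjoinRoot g) // IsFullLattice (AdjoinRoot g) L ∧ ∀ x ∈ L, AdjoinRoot.root g * x ∈ L})
        (b : Basis (Fin n) ℚ (AdjoinRoot g)), span ℤ (Set.range b) = L.1 →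
          (∀ j, AdjoinRoot.root g * b j = ∑ i, (B.1 i j : ℚ) • b i) → Φ (Quot.mk _ B) = Quot.mk _ L := by
  -- (i): the lattice of a matrix
  have hex : ∀ B : {B : Matrix (Fin n) (Fin n) ℤ // minpoly ℚ (B.map (Int.castRingHom ℚ)) = g},
      ∃ (L : {L : Submodule ℤ (AdjoinRoot g) // IsFullLattice (AdjoinRoot g) L ∧ ∀ x ∈ L, AdjoinRoot.root g * x ∈ L})
        (b : Basis (Fin n) ℚ (AdjoinRoot g)), span ℤ (Set.range b) = L.1 ∧
          ∀ j, AdjoinRoot.root g * b j = ∑ i, (B.1 i j : ℚ) • b i := fun B => by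
    obtain ⟨L, b, hL, hθ, hb, hrep⟩ := exists_isFullLattice_of_minpoly_eq hg hdeg B.2
    exact ⟨⟨L, hL, hθ⟩, b, hb, hrep⟩
  choose Λ β hβ hΛ using hex
  -- (ii): the matrix of a lattice
  have hex' : ∀ L : {L : Submodule ℤ (AdjoinRoot g) // IsFullLattice (AdjoinRoot g) L ∧ ∀ x ∈ L, AdjoinRoot.root g * x ∈ L},
      ∃ (B : {B : Matrix (Fin n) (Fin n) ℤ // minpoly ℚ (B.map (Int.castRingHom ℚ)) = g})
        (b : Basis (Fin n) ℚ (AdjoinRoot g)), span ℤ (Set.range b) = L.1 ∧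
          ∀ j, AdjoinRoot.root g * b j = ∑ i, (B.1 i j : ℚ) • b i := fun L => by
    obtain ⟨b, B, hb, hrep, hmin⟩ := exists_basis_matrix_of_isFullLattice hg hdeg L.2.1 L.2.2
    exact ⟨⟨B, hmin⟩, b, hb, hrep⟩
  choose M γ hγ hM using hex'
  let Φ : Quot (fun B B' : {B : Matrix (Fin n) (Fin n) ℤ // minpoly ℚ (B.map (Int.castRingHom ℚ)) = g} =>
        ∃ P : Matrix (Fin n) (Fin n) ℤ, IsUnit P.det ∧ P * B.1 = B'.1 * P) →
      Quot (fun L L' : {L : Submodule ℤ (AdjoinRoot g) //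
          IsFullLattice (AdjoinRoot g) L ∧ ∀ x ∈ L, AdjoinRoot.root g * x ∈ L} =>
        ∃ c : (AdjoinRoot g)ˣ, c • L.1 = L'.1) :=
    Quot.lift (fun B => Quot.mk _ (Λ B)) fun B B' ⟨P, hPdet, hP⟩ => Quot.sound <| by
      obtain ⟨c, hc⟩ := exists_units_smul_eq_of_mul_eq_mul (hΛ B) (hΛ B') hPdet hP
      exact ⟨c, by rw [← hβ B, ← hβ B', hc]⟩
  let Ψ : Quot (fun L L' : {L : Submodule ℤ (AdjoinRoot g) //
          IsFullLattice (AdjoinRoot g) L ∧ ∀ x ∈ L, AdjoinRoot.root g * x ∈ L} =>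
        ∃ c : (AdjoinRoot g)ˣ, c • L.1 = L'.1) →
      Quot (fun B B' : {B : Matrix (Fin n) (Fin n) ℤ // minpoly ℚ (B.map (Int.castRingHom ℚ)) = g} =>
        ∃ P : Matrix (Fin n) (Fin n) ℤ, IsUnit P.det ∧ P * B.1 = B'.1 * P) :=
    Quot.lift (fun L => Quot.mk _ (M L)) fun L L' ⟨c, hc⟩ => Quot.sound <| by
      refine exists_isUnit_det_mul_eq_mul_of_units_smul_eq (hM L) (hM L') c ?_
      rw [hγ L, hγ L', hc]
  have hΦ : ∀ (B : {B : Matrix (Fin n) (Fin n) ℤ // minpoly ℚ (B.map (Int.castRingHom ℚ)) = g})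
      (L : {L : Submodule ℤ (AdjoinRoot g) // IsFullLattice (AdjoinRoot g) L ∧ ∀ x ∈ L, AdjoinRoot.root g * x ∈ L})
      (b : Basis (Fin n) ℚ (AdjoinRoot g)), span ℤ (Set.range b) = L.1 →
        (∀ j, AdjoinRoot.root g * b j = ∑ i, (B.1 i j : ℚ) • b i) → Φ (Quot.mk _ B) = Quot.mk _ L := by
    intro B L b hb hrep
    change Quot.mk _ (Λ B) = Quot.mk _ L
    refine Quot.sound ?_
    obtain ⟨c, hc⟩ := exists_units_smul_eq_of_mul_eq_mul (P := 1) (hΛ B) hrep (by simp)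
      (by rw [one_mul, mul_one])
    exact ⟨c, by rw [← hβ B, ← hb, hc]⟩
  refine ⟨{ toFun := Φ, invFun := Ψ, left_inv := ?_, right_inv := ?_ }, hΦ⟩
  · rintro ⟨B⟩
    change Quot.mk _ (M (Λ B)) = Quot.mk _ B
    refine Quot.sound ?_
    -- `β B` and `γ (Λ B)` are two bases of `Λ B`, representing `B` and `M (Λ B)`
    exact exists_isUnit_det_mul_eq_mul_of_span_eq (hM (Λ B)) (hΛ B) ((hγ (Λ B)).trans (hβ B).symm)
  · rintro ⟨L⟩
    change Φ (Quot.mk _ (M L)) = Quot.mk _ L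
    exact hΦ (M L) L (γ L) (hγ L) (hM L)

/-- **«1:1 correspondence»: `#S_{1,g} = #S_{2,g}`** — the number of `GLₙ(ℤ)`-conjugacy classes of regular integer matrices
with characteristic polynomial `g` equals the number of `ε`-classes of full `θ`-stable lattices of `A_g` (as
`Nat.card`; both `0` when infinite, which happens iff `g` has a multiple root, HL Rem. 6.3 (iv)).
[cite: HertlingLarabi2026b, §6 Thm. 6.2 and Rem. 6.3 (iv)–(v), chunk p0013] -/
theorem natCard_quot_conj_eq_natCard_quot_units_smul (hg : g.Monic) (hdeg : g.natDegree = n) :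
    Nat.card (Quot (fun B B' : {B : Matrix (Fin n) (Fin n) ℤ // minpoly ℚ (B.map (Int.castRingHom ℚ)) = g} =>
        ∃ P : Matrix (Fin n) (Fin n) ℤ, IsUnit P.det ∧ P * B.1 = B'.1 * P)) =
      Nat.card (Quot (fun L L' : {L : Submodule ℤ (AdjoinRoot g) //
          IsFullLattice (AdjoinRoot g) L ∧ ∀ x ∈ L, AdjoinRoot.root g * x ∈ L} =>
        ∃ c : (AdjoinRoot g)ˣ, c • L.1 = L'.1)) := by
  obtain ⟨Φ, -⟩ := exists_equiv_quot_conj_quot_units_smul hg hdeg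
  exact Nat.card_congr Φ

/-! ## §7 Complements: the description «regular with `p_B = f`», and the class of the companion matrix -/

/-- **`S_{1,f}` as printed: an integer matrix is «regular with `p_B = f`» iff `minpoly_ℚ B = f`** — `B` regular means
`deg minpoly_ℚ B = n` (HL Def./Lemma 6.1 (c)–(d) ⟺ Horn–Johnson Thm. 3.3.15, the tree's
`natDegree_minpoly_eq_iff_minpoly_eq_charpoly`), and then `minpoly_ℚ B = p_B`.
[cite: HertlingLarabi2026b, §6 Def./Lemma 6.1 (c)(d) and Thm. 6.2, chunk p0012] -/
theorem minpoly_map_eq_iff_charpoly_eq_and_natDegree_eq {f : ℤ[X]} (hdeg : f.natDegree = n)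
    (B : Matrix (Fin n) (Fin n) ℤ) :
    minpoly ℚ (B.map (Int.castRingHom ℚ)) = f.map (Int.castRingHom ℚ) ↔
      B.charpoly = f ∧ (minpoly ℚ (B.map (Int.castRingHom ℚ))).natDegree = n := by
  have hiff := Literature.LinearAlgebra.Matrix.natDegree_minpoly_eq_iff_minpoly_eq_charpoly
    (B.map (Int.castRingHom ℚ))
  rw [Fintype.card_fin] at hiff
  constructor
  · intro h
    have hd : (minpoly ℚ (B.map (Int.castRingHom ℚ))).natDegree = n := by
      rw [h, Polynomial.natDegree_map_eq_of_injective (Int.castRingHom ℚ).injective_int, hdeg]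
    refine ⟨Polynomial.map_injective (Int.castRingHom ℚ) (Int.castRingHom ℚ).injective_int ?_, hd⟩
    rw [← Matrix.charpoly_map, ← hiff.1 hd, h]
  · rintro ⟨hc, hd⟩
    rw [hiff.1 hd, Matrix.charpoly_map, hc]

/-- **REMARK 6.3 (iii): the basis `(1, t̄, …, t̄^{n−1})` of `Λ_f = ℤ[t]/(f)` represents the COMPANION MATRIX `M_f`**
(«`μ_t̄(1, t̄, ..., t̄^{n−1}) = (t̄, t̄², ..., t̄^n) = (1, t̄, ..., t̄^{n−1})·M_f`»), with the tree's
`Literature.LinearAlgebra.Matrix.companion` (ones on the subdiagonal, last column `−(f_0, …, f_{n−1})`); so under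
`Φ` of Theorem 6.2 the class `[M_f]_ℤ` corresponds to `[Λ_f]_ε`, the unit element.
[cite: HertlingLarabi2026b, §6 Thm. 6.2 (proof) and Rem. 6.3 (iii), chunk p0013] -/
theorem root_mul_pow_eq_sum_companion {f : ℤ[X]} (hf : f.Monic) (hdeg : f.natDegree = n) (j : Fin n) :
    AdjoinRoot.root (f.map (Int.castRingHom ℚ)) * AdjoinRoot.root (f.map (Int.castRingHom ℚ)) ^ (j : ℕ) =
      ∑ i : Fin n, (((Literature.LinearAlgebra.Matrix.companion (fun i : Fin n => f.coeff i) :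
          Matrix (Fin n) (Fin n) ℤ) i j : ℤ) : ℚ) • AdjoinRoot.root (f.map (Int.castRingHom ℚ)) ^ (i : ℕ) := by
  set θ := AdjoinRoot.root (f.map (Int.castRingHom ℚ)) with hθ
  by_cases hj : (j : ℕ) + 1 = n
  · -- last column: `θ^n = -Σ f_i θ^i`
    have hg : (f.map (Int.castRingHom ℚ)).Monic := hf.map _
    have hdeg' : (f.map (Int.castRingHom ℚ)).natDegree = n := by
      rw [Polynomial.natDegree_map_eq_of_injective (Int.castRingHom ℚ).injective_int, hdeg]
    have hsum : f.map (Int.castRingHom ℚ) = X ^ n + ∑ i ∈ Finset.range n, C ((f.coeff i : ℤ) : ℚ) * X ^ i := by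
      rw [hg.as_sum, hdeg']
      simp [Polynomial.coeff_map]
    have h0 : aeval θ (f.map (Int.castRingHom ℚ)) = 0 := by rw [hθ, AdjoinRoot.aeval_eq, AdjoinRoot.mk_self]
    have h1 : aeval θ (X ^ n + ∑ i ∈ Finset.range n, C ((f.coeff i : ℤ) : ℚ) * X ^ i) = 0 := by
      rw [← hsum]; exact h0
    rw [map_add, map_pow, aeval_X, map_sum] at h1
    simp only [map_mul, aeval_C, map_pow, aeval_X] at h1
    have hn : θ ^ n = -∑ i ∈ Finset.range n, (algebraMap ℚ _ ((f.coeff i : ℤ) : ℚ)) * θ ^ i :=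
      eq_neg_of_add_eq_zero_left h1
    rw [← pow_succ', hj, hn, ← Fin.sum_univ_eq_sum_range (fun i => (algebraMap ℚ _ ((f.coeff i : ℤ) : ℚ)) * θ ^ i),
      ← Finset.sum_neg_distrib]
    refine Finset.sum_congr rfl fun i _ => ?_
    rw [Literature.LinearAlgebra.Matrix.companion_apply, if_pos hj, Int.cast_neg, neg_smul, Algebra.smul_def]
  · -- subdiagonal: `θ·θ^j = θ^{j+1}`
    have hj' : (j : ℕ) + 1 < n := lt_of_le_of_ne (Nat.succ_le_of_lt j.2) hj
    rw [← pow_succ', Finset.sum_eq_single (⟨(j : ℕ) + 1, hj'⟩ : Fin n)]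
    · rw [Literature.LinearAlgebra.Matrix.companion_apply, if_neg hj, if_pos rfl, Int.cast_one, one_smul]
    · intro i _ hi
      rw [Literature.LinearAlgebra.Matrix.companion_apply, if_neg hj, if_neg (fun h => hi (Fin.ext h)), Int.cast_zero,
        zero_smul]
    · intro h; exact (h (Finset.mem_univ _)).elim

/-- **The order `Λ_f = ℤ[t̄] = ⊕_{i<n} ℤt̄^i` is a full `θ`-stable lattice and its class is that of `M_f`:
`Φ [M_f]_ℤ = [Λ_f]_ε`** for the `Φ` of Theorem 6.2 (`minpoly_ℚ M_f = f`). [cite: HertlingLarabi2026b, §6 Rem. 6.3 (iii), chunk p0013] -/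
theorem exists_basis_pow_companion {f : ℤ[X]} (hf : f.Monic) (hdeg : f.natDegree = n) :
    ∃ b : Basis (Fin n) ℚ (AdjoinRoot (f.map (Int.castRingHom ℚ))),
      (∀ i, b i = AdjoinRoot.root (f.map (Int.castRingHom ℚ)) ^ (i : ℕ)) ∧
      (∀ j, AdjoinRoot.root (f.map (Int.castRingHom ℚ)) * b j =
        ∑ i, (((Literature.LinearAlgebra.Matrix.companion (fun i : Fin n => f.coeff i) :
          Matrix (Fin n) (Fin n) ℤ) i j : ℤ) : ℚ) • b i) ∧
      minpoly ℚ ((Literature.LinearAlgebra.Matrix.companion (fun i : Fin n => f.coeff i) :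
          Matrix (Fin n) (Fin n) ℤ).map (Int.castRingHom ℚ)) = f.map (Int.castRingHom ℚ) := by
  have hg : (f.map (Int.castRingHom ℚ)).Monic := hf.map _
  have hdeg' : (f.map (Int.castRingHom ℚ)).natDegree = n := by
    rw [Polynomial.natDegree_map_eq_of_injective (Int.castRingHom ℚ).injective_int, hdeg]
  obtain ⟨b, hb⟩ : ∃ b : Basis (Fin n) ℚ (AdjoinRoot (f.map (Int.castRingHom ℚ))),
      ∀ i, b i = AdjoinRoot.root (f.map (Int.castRingHom ℚ)) ^ (i : ℕ) := by
    refine ⟨(AdjoinRoot.powerBasis hg.ne_zero).basis.reindex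
      (finCongr (by rw [AdjoinRoot.powerBasis_dim, hdeg'])), fun i => ?_⟩
    rw [Basis.reindex_apply, PowerBasis.basis_eq_pow, AdjoinRoot.powerBasis_gen, finCongr_symm, finCongr_apply,
      Fin.val_cast]
  have hrep : ∀ j, AdjoinRoot.root (f.map (Int.castRingHom ℚ)) * b j =
      ∑ i, (((Literature.LinearAlgebra.Matrix.companion (fun i : Fin n => f.coeff i) :
          Matrix (Fin n) (Fin n) ℤ) i j : ℤ) : ℚ) • b i := fun j => by
    simp only [hb]
    exact root_mul_pow_eq_sum_companion hf hdeg j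
  refine ⟨b, hb, hrep, ?_⟩
  rw [← toMatrix_mulLeft_eq_map hrep, LinearMap.minpoly_toMatrix, minpoly_mulLeft_root hg]

end Literature.LinearAlgebra.Matrix.LatimerMacDuffeeRegular
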